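import Mathlib
import Literature.MathematicalPhysics.QuantumLattice.GermMarkov
import Literature.MathematicalPhysics.QuantumLattice.BallSpecification
import HarnessLib

/-!
# `BallSpecification.BallSpecifiedFieldLimit` — stub `stub_shellOfGermMarkov` (item stmt-CriticalPhenomena-11247), proved

THEOREM-ONLY file. Registered stub `stub_shellOfGermMarkov` (S2d) of the line `registered`
(`Cruxes/BallSpecifiedFieldLimit/Lines/birth.lean`): FROM THE GERM TO THICK SHELLS. A probability law
`μ` on `FieldConfig ℝ³ = 𝓢'(ℝ³)` whose interior events `A ∈ extEvents (ball c r)` all admit a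
`germEvents c r`-measurable version `g_A` of their conditional probability given the exterior events
`𝓕 := extEvents (closedBall c r)ᶜ` (`μ (A ∩ B) = ∫⁻_B g_A dμ` for all `B ∈ 𝓕`) is THICK-SHELL MARKOV at
`(c, r)` for every width `ε > 0`: the interior events and the far-exterior events
`extEvents (closedBall c (r + ε/2))ᶜ` are conditionally independent (`CondIndepCondExp` of
`GermMarkov.lean`, Rozanov's splitting) given the open-shell events
`extEvents (ball c (r + ε) ∖ closedBall c r)`.

## Proof

Pure measure theory (Rozanov 1982, Ch. 2 §1.3; Georgii 2011, the conditional-probability mechanism),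
isolated as `condIndepCondExp_of_measurable_versions`: let `m' ≤ mF`, `m₂ ≤ mF` be sub-σ-algebras of
the ambient one and suppose every `s ∈ m₁` has an `m'`-measurable `g` with `μ (s ∩ B) = ∫⁻_B g dμ`
for all `B ∈ mF`. Put `f := g.toReal` (integrable, `m'`-strongly measurable, `∫_B f = μ.real (s ∩ B)`
for `B ∈ mF`). Then, by uniqueness of conditional expectations
(`ae_eq_condExp_of_forall_setIntegral_eq`), `f` is a version of `μ⟦s | m'⟧` (test sets `B ∈ m' ⊆ mF`)
and `μ[1_t f | m']` is a version of `μ⟦s ∩ t | m'⟧` for `t ∈ m₂` (test sets `B ∩ t ∈ mF`); the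
pull-out property (`condExp_mul_of_stronglyMeasurable_left`) gives `μ[1_t f | m'] = f · μ⟦t | m'⟧`
a.e., whence `μ⟦s ∩ t | m'⟧ = μ⟦s | m'⟧ · μ⟦t | m'⟧` a.e. The stub is the instance
`m' := extEvents (shell_ε) ≥ germEvents c r` (`iInf₂_le ε hε`), `mF := 𝓕 ≥ m'` (the shell lies outside
`closedBall c r`), `m₁ := extEvents (ball c r)`, `m₂ := extEvents (closedBall c (r + ε/2))ᶜ ≤ 𝓕`
(`closedBall c r ⊆ closedBall c (r + ε/2)`), all Borel (`extEvents_le`). The hypotheses `0 < r` is not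
used (kept: registered signature).
-/

noncomputable section

namespace Summit.CriticalPhenomena.Ising3DConformalLimit.Theorems

open MeasureTheory ProbabilityTheory Literature.MathematicalPhysics.QuantumLattice
open scoped ENNReal ProbabilityTheory

/-- **Conditional independence from measurable versions (the germ-to-shell mechanism).** On a finite
measure space let `m' ≤ mF ≤ mΩ`, `m₁ ≤ mΩ`, `m₂ ≤ mF` be σ-algebras, and suppose every `s ∈ m₁` has an
`m'`-measurable `ℝ≥0∞`-valued `g` with `μ (s ∩ B) = ∫⁻_B g dμ` for all `B ∈ mF` (an `m'`-measurable
version of the conditional probability of `s` given the LARGER σ-algebra `mF`). Then `m'` splits `m₁`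
and `m₂`: `μ⟦s ∩ t | m'⟧ = μ⟦s | m'⟧ · μ⟦t | m'⟧` a.e. for `s ∈ m₁`, `t ∈ m₂` (Rozanov 1982, Ch. 2
§1.1–§1.3: uniqueness of conditional expectations and the pull-out property). [folklore] -/
theorem condIndepCondExp_of_measurable_versions {Ω : Type*}
    {m' mF m₁ m₂ : MeasurableSpace Ω} {mΩ : MeasurableSpace Ω} {μ : Measure Ω} [IsFiniteMeasure μ]
    (hm' : m' ≤ mF) (hF : mF ≤ mΩ) (h₁ : m₁ ≤ mΩ) (h₂ : m₂ ≤ mF)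
    (hv : ∀ s : Set Ω, MeasurableSet[m₁] s → ∃ g : Ω → ℝ≥0∞, Measurable[m'] g ∧
      ∀ B : Set Ω, MeasurableSet[mF] B → μ (s ∩ B) = ∫⁻ η in B, g η ∂μ) :
    CondIndepCondExp m' m₁ m₂ μ := by
  intro s t hs ht
  obtain ⟨g, hgm, hg⟩ := hv s hs
  have hm'Ω : m' ≤ mΩ := hm'.trans hF
  have hsΩ : MeasurableSet s := h₁ s hs
  have htF : MeasurableSet[mF] t := h₂ t ht
  have htΩ : MeasurableSet t := hF t htF
  have hgΩ : Measurable g := hgm.mono hm'Ω le_rfl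
  have hg_univ : ∫⁻ η, g η ∂μ = μ s := by
    have h := hg Set.univ MeasurableSet.univ
    rw [Measure.restrict_univ, Set.inter_univ] at h
    exact h.symm
  have hg_ne_top : ∫⁻ η, g η ∂μ ≠ ∞ := hg_univ ▸ measure_ne_top μ s
  have hg_lt_top : ∀ᵐ η ∂μ, g η < ∞ := ae_lt_top hgΩ hg_ne_top
  -- the real-valued version `f` of the conditional probability of `s`
  set f : Ω → ℝ := fun ω => (g ω).toReal with hf_def
  have hfm : StronglyMeasurable[m'] f := hgm.ennreal_toReal.stronglyMeasurable
  have hf_int : Integrable f μ := integrable_toReal_of_lintegral_ne_top hgΩ.aemeasurable hg_ne_top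
  have hf_set : ∀ B : Set Ω, MeasurableSet[mF] B → ∫ x in B, f x ∂μ = μ.real (s ∩ B) := by
    intro B hB
    rw [integral_toReal hgΩ.aemeasurable.restrict (ae_restrict_of_ae hg_lt_top), ← hg B hB,
      measureReal_def]
  -- (i) `f` is a version of `μ⟦s | m'⟧`
  have h1 : f =ᵐ[μ] μ⟦s | m'⟧ := by
    refine ae_eq_condExp_of_forall_setIntegral_eq hm'Ω ((integrable_const (1 : ℝ)).indicator hsΩ)
      (fun B _ _ => hf_int.integrableOn) (fun B hB _ => ?_) hfm.aestronglyMeasurable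
    rw [hf_set B (hm' B hB), integral_indicator_const _ hsΩ, measureReal_restrict_apply hsΩ,
      smul_eq_mul, mul_one]
  -- (ii) `μ[1_t f | m']` is a version of `μ⟦s ∩ t | m'⟧`
  have hft_int : Integrable (t.indicator f) μ := hf_int.indicator htΩ
  have h2 : μ[t.indicator f | m'] =ᵐ[μ] μ⟦s ∩ t | m'⟧ := by
    refine ae_eq_condExp_of_forall_setIntegral_eq hm'Ω
      ((integrable_const (1 : ℝ)).indicator (hsΩ.inter htΩ))
      (fun B _ _ => integrable_condExp.integrableOn) (fun B hB _ => ?_)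
      stronglyMeasurable_condExp.aestronglyMeasurable
    rw [setIntegral_condExp hm'Ω hft_int hB, setIntegral_indicator htΩ,
      hf_set (B ∩ t) ((hm' B hB).inter htF), integral_indicator_const _ (hsΩ.inter htΩ),
      measureReal_restrict_apply (hsΩ.inter htΩ), smul_eq_mul, mul_one, Set.inter_comm B t,
      ← Set.inter_assoc]
  -- (iii) pull-out of the `m'`-measurable factor `f`
  have hprod : f * t.indicator (fun _ => (1 : ℝ)) = t.indicator f := by
    funext ω
    by_cases hω : ω ∈ t <;> simp [hω]
  have h3 : μ[t.indicator f | m'] =ᵐ[μ] f * μ⟦t | m'⟧ := by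
    have h := condExp_mul_of_stronglyMeasurable_left (μ := μ) hfm (hprod ▸ hft_int)
      ((integrable_const (1 : ℝ)).indicator htΩ)
    rwa [hprod] at h
  calc μ⟦s ∩ t | m'⟧ =ᵐ[μ] μ[t.indicator f | m'] := h2.symm
    _ =ᵐ[μ] f * μ⟦t | m'⟧ := h3
    _ =ᵐ[μ] μ⟦s | m'⟧ * μ⟦t | m'⟧ := h1.mul_right

/-- **Registered stub `stub_shellOfGermMarkov` (S2d · from the germ to thick shells), proved**: a
probability law on `FieldConfig ℝ³` whose interior events `A ∈ extEvents (ball c r)` have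
`germEvents c r`-measurable versions of their conditional probabilities given the exterior events
`extEvents (closedBall c r)ᶜ` is thick-shell Markov at `(c, r)` for every width `ε > 0`: the interior
events and the far-exterior events `extEvents (closedBall c (r + ε/2))ᶜ` are conditionally independent
given the open-shell events `extEvents (ball c (r + ε) ∖ closedBall c r)`. Instance of
`condIndepCondExp_of_measurable_versions` with `germEvents c r ≤ extEvents (shell) ≤ extEvents
(closedBall c r)ᶜ ≥ extEvents (closedBall c (r + ε/2))ᶜ` (Rozanov 1982, Ch. 2 §1.3, one-sided form).
[folklore] -/
theorem stub_shellOfGermMarkov :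
    ∀ (μ : MeasureTheory.Measure (Literature.MathematicalPhysics.QuantumLattice.FieldConfig (EuclideanSpace ℝ (Fin 3)))),
      MeasureTheory.IsProbabilityMeasure μ →
      ∀ (c : EuclideanSpace ℝ (Fin 3)) (r : ℝ), 0 < r →
        (∀ A : Set (Literature.MathematicalPhysics.QuantumLattice.FieldConfig (EuclideanSpace ℝ (Fin 3))),
          MeasurableSet[Literature.MathematicalPhysics.QuantumLattice.extEvents (Metric.ball c r)] A →
          ∃ g : Literature.MathematicalPhysics.QuantumLattice.FieldConfig (EuclideanSpace ℝ (Fin 3)) → ENNReal,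
            Measurable[Literature.MathematicalPhysics.QuantumLattice.germEvents c r] g ∧
            ∀ B : Set (Literature.MathematicalPhysics.QuantumLattice.FieldConfig (EuclideanSpace ℝ (Fin 3))),
              MeasurableSet[Literature.MathematicalPhysics.QuantumLattice.extEvents (Metric.closedBall c r)ᶜ] B →
              μ (A ∩ B) = ∫⁻ η in B, g η ∂μ) →
        ∀ ε : ℝ, 0 < ε →
          Literature.MathematicalPhysics.QuantumLattice.CondIndepCondExp
          (Literature.MathematicalPhysics.QuantumLattice.extEvents (Metric.ball c (r + ε) \ Metric.closedBall c r))
          (Literature.MathematicalPhysics.QuantumLattice.extEvents (Metric.ball c r))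
          (Literature.MathematicalPhysics.QuantumLattice.extEvents (Metric.closedBall c (r + ε / 2))ᶜ)
          μ := by
  intro μ hμ c r _hr hM ε hε
  -- the σ-algebra inclusions `germ ≤ shell ≤ exterior ≥ far exterior`
  have hGSh : germEvents c r ≤ extEvents (Metric.ball c (r + ε) \ Metric.closedBall c r) :=
    iInf₂_le ε hε
  have hShF : extEvents (E := EuclideanSpace ℝ (Fin 3)) (Metric.ball c (r + ε) \ Metric.closedBall c r)
      ≤ extEvents (Metric.closedBall c r)ᶜ :=
    extEvents_mono (Set.sdiff_subset_compl _ _)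
  have hXF : extEvents (E := EuclideanSpace ℝ (Fin 3)) (Metric.closedBall c (r + ε / 2))ᶜ
      ≤ extEvents (Metric.closedBall c r)ᶜ :=
    extEvents_mono (Set.compl_subset_compl.2 (Metric.closedBall_subset_closedBall (by linarith)))
  refine condIndepCondExp_of_measurable_versions hShF (extEvents_le _) (extEvents_le _) hXF ?_
  intro A hA
  obtain ⟨g, hg, hgB⟩ := hM A hA
  exact ⟨g, hg.mono hGSh le_rfl, hgB⟩

end Summit.CriticalPhenomena.Ising3DConformalLimit.Theorems

end
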